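/-
Copyright (c) 2026 the pub-hodgecm-mathlib formalisation cell (harness21).  Prover seat hodgecm-mathlib-F0P2-p10 (g4), Track B ∕ R90-TF, h413 = `stmt-HodgeConjecture-24833`,
R90-TF section S8 «ContSpec-n½», socket (E) :276, E1-PLANCHEREL BODY, letter `hFub` piece (a) (S8 dealer R90-CS-plan (g4) S8-R285; joint census `R90/S8/CENSUS-PlancherelBody-bricks.K2E1-p16-F0P2-p10.md` §PB-1):
MELLIN INVERSION INSIDE ★ C2's ORBITAL INTEGRAL — `CT θ_{f,ψ}(g) − f(Hg)ψ(g) = (ν𝓕)⁻¹•∫_{N(𝔸)} ((2π)⁻¹∫ H(w₀vg)^{w}·mellin f(−w) dy′)·ψ(w₀vg) dν(v)` pointwise in `(v, g)`, `f ∈ C²_c((0,∞))`, no Fubini.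
-/
import Summits.HodgeConjecture.HodgeConjecture.Theorems.K2E1ChiPseudoEisensteinRadialCMThree    -- ★ C2 p862856: `borelConstantTerm_eisensteinSeriesU_comp_borelHeight_mul_cm_three` (constant term = main + orbital integral)
import Summits.HodgeConjecture.HodgeConjecture.Theorems.K2E1MellinPaleyWienerHalfLine           -- ★ A: `eq_integral_cpow_mul_mellin_neg` (Mellin inversion, `H^z` convention, `f ∈ C²_c((0,∞))`)
import HarnessLib

/-!
# hFub-a — `K2E1ChiOrbitalIntegralMellinInsideCMThree`: MELLIN INVERSION INSIDE THE ORBITAL (INTERTWINING) INTEGRAL OF THE CONSTANT TERM ON `U(2,1)`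

Track B ∕ R90-TF, crux h413 = `stmt-HodgeConjecture-24833`, route of record `HCCMUnconditional`; cell `hodgecm-mathlib`, R90-TF programme, section S8 «ContSpec-n½», socket (E)
(B ED. 7 :276), E1-PLANCHEREL BODY.  After ★ PB-1a p865168, ★ PB-1b p865195 + p865252, ★ PB-1c-0 p865290 and ★ PB-1c-1 p865336, MW's two-term inner-product formula II.2.1 for
`θ_{f,φ}` on `U(2,1)_{L∕L⁺}` is ★ modulo ONE named letter `hFub` = the intertwined bracket `[Ψ₂]_β` in idele-class currency.  `hFub` is cut into (a) Mellin inversion inside ★ C2's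
orbital integral (THIS FILE, S), (b) the Fubini swap `N(𝔸) × {Re w = c₀ > 2}` in the Godement range (M), (c) the `G`-unfolding with the reflected-pair dichotomy (analytic hand).
THEOREMS ONLY (no `def`, no `instance`, no notation, no named-fact hypothesis, no `sorry`; default heartbeats); lane `--supports stmt-HodgeConjecture-24833 --as helper` (count-neutral).

THE MATHEMATICS ([MoeglinWaldspurger1995] II.1.4, II.1.7; [Titchmarsh1948] Thm 71–72).  ★ C2 `K2E1ChiPseudoEisensteinRadialCMThree.borelConstantTerm_eisensteinSeriesU_comp_borelHeight_mul_cm_three`: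
`CT θ_{f,ψ}(g) = f(Hg)·ψ(g) + (ν𝓕)⁻¹•∫_{N(𝔸)} f(H(w₀vg))·ψ(w₀vg) dν(v)` (section-generic, no continuation).  ★ A `eq_integral_cpow_mul_mellin_neg`: for `f ∈ C²_c((0,∞))`, every `σ₀` and
`r > 0`, `f(r) = (2π)⁻¹∫_ℝ r^{σ₀+iy}·mellin f(−(σ₀+iy)) dy`.  Since `H > 0` everywhere (★ `borelHeight_pos`), the inversion holds POINTWISE at `r = H(x)` for every `x ∈ G(𝔸)` (§1, generic
`(F, E, c, N)`), hence inside any integral `∫ f(H(Γ a))·ψ(Γ a) dμ(a)` by `integral_congr` — no integrability, no Fubini (§1); §2 plugs `Γ = v ↦ w₀·v·g` into ★ C2 on `U(2,1)_{L∕L⁺}`: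
**`CT θ_{f,ψ}(g) − f(Hg)ψ(g) = (ν𝓕)⁻¹•∫_{N(𝔸)} ((2π)⁻¹∫_ℝ H(w₀vg)^{σ₀+iy}·mellin f(−(σ₀+iy)) dy)·ψ(w₀vg) dν(v)`** for every `σ₀ ∈ ℝ` and every `g`.
NEXT (hFub-b, not here): for `σ₀ = c₀ > 2` swap `∫_{N(𝔸)}` and `∫_ℝ` (absolute convergence of `∫_N H(w₀vg)^{c₀}‖ψ(w₀vg)‖ dν`, ★ `norm_chiLocalMean_le` place by place + the Heisenberg Tonelli pattern),
making the inner `∫_N H(w₀vg)^{w}ψ(w₀vg) dν = (M(w₀,w)ψ)(g)·H(g)^{2−w}`-type intertwined coefficient appear (★ `K2E1ChiIntertwinedSectionU3.flatSectionU_intertwinedCoeff_three_eq`).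

HONEST LABEL.  Piece (a) of one named letter; pays nothing at the (E) socket.  HC_CM is proved only modulo the 7 printed citations (2 remaining named inputs: hLiu418 =
`stmt-HodgeConjecture-24832`, h413 = `stmt-HodgeConjecture-24833`) until rung 0 closes; count-neutral.
-/

set_option autoImplicit false
set_option linter.dupNamespace false  -- the mandated namespace repeats the summit's segment (`HodgeConjecture.HodgeConjecture`)

noncomputable section

open MeasureTheory Measure Set Filter Topology Complex NumberField IsDedekindDomain MulAction
open scoped Real NNReal ENNReal ComplexConjugate
open Literature.MeasureTheory.Group Literature.NumberTheory
open Literature.NumberTheory.Automorphic Literature.NumberTheory.Automorphic.UnitaryGroup AdelicGroupData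
open Literature.NumberTheory.GaloisRepresentations (HeckeCharacter ideleGroup)
open Summit.HodgeConjecture.HodgeConjecture.Cruxes.H413.K2E1BorelEisensteinU
open Summit.HodgeConjecture.HodgeConjecture.Cruxes.H413.K2E1MellinPaleyWienerHalfLine (eq_integral_cpow_mul_mellin_neg)
open Summit.HodgeConjecture.HodgeConjecture.Cruxes.H413.K2E1ChiPseudoEisensteinRadialCMThree (borelConstantTerm_eisensteinSeriesU_comp_borelHeight_mul_cm_three)

namespace Summit.HodgeConjecture.HodgeConjecture.Cruxes.H413.K2E1ChiOrbitalIntegralMellinInsideCMThree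

/-! ## §1 Generic `(F, E, c, N)`: Mellin inversion at `r = H(x)`, pointwise and inside any integral -/

section Generic

variable {F E : Type} [Field F] [NumberField F] [Field E] [NumberField E] [Algebra F E] {c : E ≃ₐ[F] E} {N : ℕ} [NeZero N]

/-- **Mellin inversion at the Borel height**: `f(H x) = (2π)⁻¹∫_ℝ H(x)^{σ₀+iy}·mellin f(−(σ₀+iy)) dy` for `f ∈ C²_c((0,∞))`, every `σ₀` and every `x ∈ G(𝔸)` (★ A `eq_integral_cpow_mul_mellin_neg`
at `r = H(x) > 0`, ★ `borelHeight_pos`). [cite: MoeglinWaldspurger1995, II.1.4] [cite: Titchmarsh1948, Thm 71–72] -/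
theorem comp_borelHeight_eq_integral_cpow_mul_mellin {f : ℝ → ℂ} (hf : ContDiff ℝ 2 f) (hfs : HasCompactSupport f) (hf0 : tsupport f ⊆ Ioi 0) (σ₀ : ℝ)
    (x : (quasiSplit F E c N).Adelic) :
    f (borelHeight x : ℝ) = (((2 * π)⁻¹ : ℝ) : ℂ) * ∫ y : ℝ, ((borelHeight x : ℝ) : ℂ) ^ ((σ₀ : ℂ) + y * I) * mellin f (-((σ₀ : ℂ) + y * I)) :=
  eq_integral_cpow_mul_mellin_neg hf hfs hf0 σ₀ (by exact_mod_cast borelHeight_pos x)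

/-- **Mellin inversion of the radial coefficient, pointwise**: `f(H x)·ψ(x) = ((2π)⁻¹∫ H(x)^{σ₀+iy}·mellin f(−(σ₀+iy)) dy)·ψ(x)` for every `x`. [cite: MoeglinWaldspurger1995, II.1.4] -/
theorem comp_borelHeight_mul_eq_integral_mellin_mul {f : ℝ → ℂ} (hf : ContDiff ℝ 2 f) (hfs : HasCompactSupport f) (hf0 : tsupport f ⊆ Ioi 0) (σ₀ : ℝ)
    (ψ : (quasiSplit F E c N).Adelic → ℂ) (x : (quasiSplit F E c N).Adelic) :
    f (borelHeight x : ℝ) * ψ x = ((((2 * π)⁻¹ : ℝ) : ℂ) * ∫ y : ℝ, ((borelHeight x : ℝ) : ℂ) ^ ((σ₀ : ℂ) + y * I) * mellin f (-((σ₀ : ℂ) + y * I))) * ψ x := by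
  rw [← comp_borelHeight_eq_integral_cpow_mul_mellin hf hfs hf0 σ₀ x]

/-- **Mellin inversion INSIDE an integral, no Fubini**: for any measure space `(α, μ)`, any map `Γ : α → G(𝔸)` (e.g. `v ↦ w₀·v·g` on `N(𝔸)`) and any `ψ`,
`∫ f(H(Γ a))·ψ(Γ a) dμ(a) = ∫ ((2π)⁻¹∫_ℝ H(Γ a)^{σ₀+iy}·mellin f(−(σ₀+iy)) dy)·ψ(Γ a) dμ(a)` — the integrands agree pointwise (`integral_congr_ae`), so no integrability is needed.
[cite: MoeglinWaldspurger1995, II.1.4, II.1.7] -/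
theorem integral_comp_borelHeight_mul_eq_integral_mellin_inside {α : Type*} [MeasurableSpace α] (μ : Measure α) (Γ : α → (quasiSplit F E c N).Adelic)
    (ψ : (quasiSplit F E c N).Adelic → ℂ) {f : ℝ → ℂ} (hf : ContDiff ℝ 2 f) (hfs : HasCompactSupport f) (hf0 : tsupport f ⊆ Ioi 0) (σ₀ : ℝ) :
    ∫ a, f (borelHeight (Γ a) : ℝ) * ψ (Γ a) ∂μ =
      ∫ a, ((((2 * π)⁻¹ : ℝ) : ℂ) * ∫ y : ℝ, ((borelHeight (Γ a) : ℝ) : ℂ) ^ ((σ₀ : ℂ) + y * I) * mellin f (-((σ₀ : ℂ) + y * I))) * ψ (Γ a) ∂μ :=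
  integral_congr_ae (Eventually.of_forall fun a => comp_borelHeight_mul_eq_integral_mellin_mul hf hfs hf0 σ₀ ψ (Γ a))

end Generic

/-! ## §2 HEAD on `U(2,1)_{L∕L⁺}`: the constant term minus the main term = the orbital integral with Mellin inversion inside -/

section CM

variable (L : Type) [Field L] [NumberField L] [IsCMField L]
variable [MeasurableSpace (quasiSplit (↥(maximalRealSubfield L)) L (IsCMField.complexConj L) 3).Adelic] [BorelSpace (quasiSplit (↥(maximalRealSubfield L)) L (IsCMField.complexConj L) 3).Adelic]

/-- **hFub-a — THE CONSTANT TERM WITH MELLIN INVERSION INSIDE THE ORBITAL INTEGRAL.**  Data as in ★ C2: a Haar measure `ν` on `N(𝔸_{L⁺})`, a fundamental domain `𝓕` of `N(L⁺)` with compact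
closure, `f ∈ C²_c((0,∞))`, `ψ` continuous bounded, left-`N(𝔸)`- and left-`B(L⁺)`-invariant; every `σ₀ ∈ ℝ` and every `g`:
**`CT θ_{f,ψ}(g) = f(Hg)·ψ(g) + (ν𝓕)⁻¹•∫_{N(𝔸)} ((2π)⁻¹∫_ℝ H(w₀vg)^{σ₀+iy}·mellin f(−(σ₀+iy)) dy)·ψ(w₀vg) dν(v)`** — ★ C2 then §1 inside `∫_{N(𝔸)}` (pointwise in `(v,g)`, no Fubini).
[cite: MoeglinWaldspurger1995, II.1.7] [cite: Titchmarsh1948, Thm 71–72] -/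
theorem borelConstantTerm_eq_add_orbital_mellin_inside_cm_three (ν : Measure ↥(adelicUnipotent (↥(maximalRealSubfield L)) L (IsCMField.complexConj L) 3)) [ν.IsHaarMeasure]
    {𝓕 : Set ↥(adelicUnipotent (↥(maximalRealSubfield L)) L (IsCMField.complexConj L) 3)}
    (h𝓕N : IsFundamentalDomain ↥(rationalUnipotent (↥(maximalRealSubfield L)) L (IsCMField.complexConj L) 3) 𝓕 ν) (h𝓕c : IsCompact (closure 𝓕))
    {f : ℝ → ℂ} (hf : ContDiff ℝ 2 f) (hfs : HasCompactSupport f) (hf0 : tsupport f ⊆ Ioi 0)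
    {ψ : (quasiSplit (↥(maximalRealSubfield L)) L (IsCMField.complexConj L) 3).Adelic → ℂ} (hψc : Continuous ψ) {M : ℝ} (hψM : ∀ x, ‖ψ x‖ ≤ M)
    (hψN : ∀ (u : ↥(adelicUnipotent (↥(maximalRealSubfield L)) L (IsCMField.complexConj L) 3)) (x : (quasiSplit (↥(maximalRealSubfield L)) L (IsCMField.complexConj L) 3).Adelic),
      ψ ((u : (quasiSplit (↥(maximalRealSubfield L)) L (IsCMField.complexConj L) 3).Adelic) * x) = ψ x)
    (hψB : ∀ b ∈ borelU ((IsCMField.complexConj L : L ≃ₐ[↥(maximalRealSubfield L)] L) : L →+* L) ((StdForm.antidiagonal 3).over L), ∀ x : (quasiSplit (↥(maximalRealSubfield L)) L (IsCMField.complexConj L) 3).Adelic,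
      ψ ((quasiSplit (↥(maximalRealSubfield L)) L (IsCMField.complexConj L) 3).toAdelic b * x) = ψ x)
    (σ₀ : ℝ) (g : (quasiSplit (↥(maximalRealSubfield L)) L (IsCMField.complexConj L) 3).Adelic) :
    borelConstantTerm ν 𝓕 (eisensteinSeriesU (fun x : (quasiSplit (↥(maximalRealSubfield L)) L (IsCMField.complexConj L) 3).Adelic => f (borelHeight x : ℝ) * ψ x)) g =
      f (borelHeight g : ℝ) * ψ g + ((ν 𝓕).toReal⁻¹ : ℝ) • ∫ v : ↥(adelicUnipotent (↥(maximalRealSubfield L)) L (IsCMField.complexConj L) 3),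
        ((((2 * π)⁻¹ : ℝ) : ℂ) * ∫ y : ℝ, ((borelHeight ((quasiSplit (↥(maximalRealSubfield L)) L (IsCMField.complexConj L) 3).toAdelic (weylLongU ((IsCMField.complexConj L : L ≃ₐ[↥(maximalRealSubfield L)] L) : L →+* L) (rfl : (StdForm.antidiagonal 3).over L = (StdForm.antidiagonal 3).over L)) *
          (v : (quasiSplit (↥(maximalRealSubfield L)) L (IsCMField.complexConj L) 3).Adelic) * g) : ℝ) : ℂ) ^ ((σ₀ : ℂ) + y * I) * mellin f (-((σ₀ : ℂ) + y * I))) *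
        ψ ((quasiSplit (↥(maximalRealSubfield L)) L (IsCMField.complexConj L) 3).toAdelic (weylLongU ((IsCMField.complexConj L : L ≃ₐ[↥(maximalRealSubfield L)] L) : L →+* L) (rfl : (StdForm.antidiagonal 3).over L = (StdForm.antidiagonal 3).over L)) *
          (v : (quasiSplit (↥(maximalRealSubfield L)) L (IsCMField.complexConj L) 3).Adelic) * g) ∂ν := by
  rw [borelConstantTerm_eisensteinSeriesU_comp_borelHeight_mul_cm_three L ν h𝓕N h𝓕c hf.continuous hfs hf0 hψc hψM hψN hψB g,
    integral_comp_borelHeight_mul_eq_integral_mellin_inside ν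
      (fun v : ↥(adelicUnipotent (↥(maximalRealSubfield L)) L (IsCMField.complexConj L) 3) =>
        (quasiSplit (↥(maximalRealSubfield L)) L (IsCMField.complexConj L) 3).toAdelic (weylLongU ((IsCMField.complexConj L : L ≃ₐ[↥(maximalRealSubfield L)] L) : L →+* L) (rfl : (StdForm.antidiagonal 3).over L = (StdForm.antidiagonal 3).over L)) *
          (v : (quasiSplit (↥(maximalRealSubfield L)) L (IsCMField.complexConj L) 3).Adelic) * g)
      ψ hf hfs hf0 σ₀]

/-- **hFub-a, subtracted form** (the shape ★ PB-1a's `Ψ₂ = (f∘H)φ·conj(CT θ′ − (f′∘H)φ′)` consumes): with the same data,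
**`CT θ_{f,ψ}(g) − f(Hg)·ψ(g) = (ν𝓕)⁻¹•∫_{N(𝔸)} ((2π)⁻¹∫_ℝ H(w₀vg)^{σ₀+iy}·mellin f(−(σ₀+iy)) dy)·ψ(w₀vg) dν(v)`** for every `σ₀` and `g`.
[cite: MoeglinWaldspurger1995, II.1.7] [cite: Titchmarsh1948, Thm 71–72] -/
theorem borelConstantTerm_sub_eq_orbital_mellin_inside_cm_three (ν : Measure ↥(adelicUnipotent (↥(maximalRealSubfield L)) L (IsCMField.complexConj L) 3)) [ν.IsHaarMeasure]
    {𝓕 : Set ↥(adelicUnipotent (↥(maximalRealSubfield L)) L (IsCMField.complexConj L) 3)}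
    (h𝓕N : IsFundamentalDomain ↥(rationalUnipotent (↥(maximalRealSubfield L)) L (IsCMField.complexConj L) 3) 𝓕 ν) (h𝓕c : IsCompact (closure 𝓕))
    {f : ℝ → ℂ} (hf : ContDiff ℝ 2 f) (hfs : HasCompactSupport f) (hf0 : tsupport f ⊆ Ioi 0)
    {ψ : (quasiSplit (↥(maximalRealSubfield L)) L (IsCMField.complexConj L) 3).Adelic → ℂ} (hψc : Continuous ψ) {M : ℝ} (hψM : ∀ x, ‖ψ x‖ ≤ M)
    (hψN : ∀ (u : ↥(adelicUnipotent (↥(maximalRealSubfield L)) L (IsCMField.complexConj L) 3)) (x : (quasiSplit (↥(maximalRealSubfield L)) L (IsCMField.complexConj L) 3).Adelic),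
      ψ ((u : (quasiSplit (↥(maximalRealSubfield L)) L (IsCMField.complexConj L) 3).Adelic) * x) = ψ x)
    (hψB : ∀ b ∈ borelU ((IsCMField.complexConj L : L ≃ₐ[↥(maximalRealSubfield L)] L) : L →+* L) ((StdForm.antidiagonal 3).over L), ∀ x : (quasiSplit (↥(maximalRealSubfield L)) L (IsCMField.complexConj L) 3).Adelic,
      ψ ((quasiSplit (↥(maximalRealSubfield L)) L (IsCMField.complexConj L) 3).toAdelic b * x) = ψ x)
    (σ₀ : ℝ) (g : (quasiSplit (↥(maximalRealSubfield L)) L (IsCMField.complexConj L) 3).Adelic) :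
    borelConstantTerm ν 𝓕 (eisensteinSeriesU (fun x : (quasiSplit (↥(maximalRealSubfield L)) L (IsCMField.complexConj L) 3).Adelic => f (borelHeight x : ℝ) * ψ x)) g -
        f (borelHeight g : ℝ) * ψ g =
      ((ν 𝓕).toReal⁻¹ : ℝ) • ∫ v : ↥(adelicUnipotent (↥(maximalRealSubfield L)) L (IsCMField.complexConj L) 3),
        ((((2 * π)⁻¹ : ℝ) : ℂ) * ∫ y : ℝ, ((borelHeight ((quasiSplit (↥(maximalRealSubfield L)) L (IsCMField.complexConj L) 3).toAdelic (weylLongU ((IsCMField.complexConj L : L ≃ₐ[↥(maximalRealSubfield L)] L) : L →+* L) (rfl : (StdForm.antidiagonal 3).over L = (StdForm.antidiagonal 3).over L)) *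
          (v : (quasiSplit (↥(maximalRealSubfield L)) L (IsCMField.complexConj L) 3).Adelic) * g) : ℝ) : ℂ) ^ ((σ₀ : ℂ) + y * I) * mellin f (-((σ₀ : ℂ) + y * I))) *
        ψ ((quasiSplit (↥(maximalRealSubfield L)) L (IsCMField.complexConj L) 3).toAdelic (weylLongU ((IsCMField.complexConj L : L ≃ₐ[↥(maximalRealSubfield L)] L) : L →+* L) (rfl : (StdForm.antidiagonal 3).over L = (StdForm.antidiagonal 3).over L)) *
          (v : (quasiSplit (↥(maximalRealSubfield L)) L (IsCMField.complexConj L) 3).Adelic) * g) ∂ν := by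
  rw [borelConstantTerm_eq_add_orbital_mellin_inside_cm_three L ν h𝓕N h𝓕c hf hfs hf0 hψc hψM hψN hψB σ₀ g, add_sub_cancel_left]

end CM

end Summit.HodgeConjecture.HodgeConjecture.Cruxes.H413.K2E1ChiOrbitalIntegralMellinInsideCMThree

end
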